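import Summits.Ventures.HodgeRepro2.T5RecordJointNine

/-!
# Joint consistency on `ℚ(ζ₉)` at the places above `2` and `17` — the numerals

Tier-5 support N3 / §G-N4.2 (seat p3, gen 88). The numerals of file 365 (`T5RecordJointNine`) on the record's third
sextic Galois CM field `ℚ(ζ₉)`, with the places supplied from the record's census (file 280):

* **`joint_nine_two`** — at every place `v` of `ℚ(ζ₉)⁺` above `2` (`2` is inert of degree `6` in `ℚ(ζ₉)`:
  `f(v/2) = 3`, `N(v) = 8`; `exists_map_eq_two`): the place `w` with `v 𝓞_K = w` is supplied and the joint statement of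
  file 356 holds (Satake parameter `α · 8⁻²`);
* **`joint_nine_seventeen`** — the same above `17` (`17 ≡ −1 (mod 9)`: `f(v/17) = 1`, `N(v) = 17`, a DEGREE-ONE inert
  place; `exists_map_eq_seventeen`; Satake parameter `α · 17⁻²`).

§8(d): uses an L-value-free non-vanishing device: NO.
-/

open Matrix NumberField NumberField.IsCMField IsDedekindDomain IsDedekindDomain.HeightOneSpectrum Module
  MulAction
open scoped TensorProduct Pointwise
open Summit.Ventures.HodgeRepro2.T5UnitaryGroupForm Summit.Ventures.HodgeRepro2.T5UnitaryHeckeAdjoint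
  Summit.Ventures.HodgeRepro2.T5HeckePermutationModule Summit.Ventures.HodgeRepro2.LevelPositivity
  Summit.Ventures.HodgeRepro2.T5LevelIdempotent Summit.Ventures.HodgeRepro2.T5StarOfInvolution
  Summit.Ventures.HodgeRepro2.T5FinitePlaceCM Summit.Ventures.HodgeRepro2.T5NonSplitPlaceUnitaryGroup
  Summit.Ventures.HodgeRepro2.T5RecordHyperspecial Summit.Ventures.HodgeRepro2.T5GlobalLatticeAlmostAll
  Summit.Ventures.HodgeRepro2.T5HermitianThreeElements Summit.Ventures.HodgeRepro2.T5GaloisCartanThree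
  Summit.Ventures.HodgeRepro2.T5InertDegreeGalois Summit.Ventures.HodgeRepro2.T5InertPlaceCompletion
  Summit.Ventures.HodgeRepro2.T5InertDegreeAdicCompletion Summit.Ventures.HodgeRepro2.T5InertSatakeTransform
  Summit.Ventures.HodgeRepro2.T5InertSatakeTransformCompletion Summit.Ventures.HodgeRepro2.T5InertUnipotentResidue
  Summit.Ventures.HodgeRepro2.T5InertSphericalSubquotient Summit.Ventures.HodgeRepro2.T5RecordSatakeCell
  Summit.Ventures.HodgeRepro2.T5SplitPlaceUnitaryGroup Summit.Ventures.HodgeRepro2.T5FinitePlaceNormIndex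
  Summit.Ventures.HodgeRepro2.T5HermitianLocalIsotropyN3 Summit.Ventures.HodgeRepro2.T5FinitePlaceSplitClassification
  Summit.Ventures.HodgeRepro2.T5InertDegreeCompletion Summit.Ventures.HodgeRepro2.T5InertPlaceCompletionCells
  Summit.Ventures.HodgeRepro2.T5RecordSatake Summit.Ventures.HodgeRepro2.T5CartanCellsDistinct
  Summit.Ventures.HodgeRepro2.T5RecordSatakeInert Summit.Ventures.HodgeRepro2.T5InertGlobalPrime
  Summit.Ventures.HodgeRepro2.T5CMFieldSquareDatum Summit.Ventures.HodgeRepro2.T5RecordSatakeDegree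
  Summit.Ventures.HodgeRepro2.T5RecordSatakeDegreeIntrinsic Summit.Ventures.HodgeRepro2.T5RecordSphericalSpectrum
  Summit.Ventures.HodgeRepro2.T5RecordSphericalSpectrumIntrinsic Summit.Ventures.HodgeRepro2.T5RecordSatakeToy
  Summit.Ventures.HodgeRepro2.T5RecordSphericalSpectrumDatumFree
  Summit.Ventures.HodgeRepro2.T5AdditiveConductor Summit.Ventures.HodgeRepro2.T5UnitaryGroupIsometry
  Summit.Ventures.HodgeRepro2.T5ConductorDualLattice Summit.Ventures.HodgeRepro2.T5ConductorDualLatticeSplit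
  Summit.Ventures.HodgeRepro2.T5SplitHermitianClass Summit.Ventures.HodgeRepro2.T5RecordLatticeModelOutsideDiscriminant
  Summit.Ventures.HodgeRepro2.T5RecordLatticeModelSeven Summit.Ventures.HodgeRepro2.T5RecordJointOutsideDiscriminant
  Summit.Ventures.HodgeRepro2.T5RationalPlace Summit.Ventures.HodgeRepro2.T5DiscriminantUnramified
  Summit.Ventures.HodgeRepro2.T5CyclotomicSevenHeckeCommutative
  Summit.Ventures.HodgeRepro2.T5CyclotomicNineSextic Summit.Ventures.HodgeRepro2.T5CyclotomicSevenSplitPrime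


namespace Summit.Ventures.HodgeRepro2.T5RecordJointNineNumerals

open Summit.Ventures.HodgeRepro2.T5RecordJointNine

universe uV

variable (K : Type*) [Field K] [CharZero K] [IsCyclotomicExtension {9} ℚ K]
variable (k : Type*) [Field k] [CharZero k] [IsAlgClosed k]
/-- **JOINT CONSISTENCY ON `ℚ(ζ₉)` AT EVERY PLACE ABOVE `2`** (`2` is inert of degree `6`: `f(v/2) = 3`, `N(v) = 8`,
the record's `exists_map_eq_two`): the place `w` with `v 𝓞_K = w` is supplied. -/
theorem joint_nine_two (P : Ideal (𝓞 K)) [P.IsPrime] [P.LiesOver (Ideal.span {(2 : ℤ)})]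
    (v : HeightOneSpectrum (𝓞 (maximalRealSubfield K))) [P.LiesOver v.asIdeal] :
    haveI := numberField_nine K
    haveI := isCMField_nine K
    letI : v.asIdeal.LiesOver (vRat 2).asIdeal := liesOver_vRat_of_mem 2 v (natCast_mem_of_liesOver_of_liesOver K 2 P v)
    ∃ (w : HeightOneSpectrum (𝓞 K))
      (hmap : Ideal.map (algebraMap (𝓞 (maximalRealSubfield K)) (𝓞 K)) v.asIdeal = w.asIdeal),
      letI := liesOver_of_map_eq K v w hmap
      ((∃ ψ : AddChar ((vRat 2).adicCompletion ℚ) Circle, Continuous ψ ∧ (∃ y, ψ y ≠ 1) ∧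
        conductorExp ψ (Valued.v : Valuation ((vRat 2).adicCompletion ℚ) (WithZero (Multiplicative ℤ))) = 0 ∧
        conductorExp (ψ.compAddMonoidHom
          (Algebra.trace ((vRat 2).adicCompletion ℚ) (v.adicCompletion (maximalRealSubfield K))).toAddMonoidHom)
          (Valued.v : Valuation (v.adicCompletion (maximalRealSubfield K)) (WithZero (Multiplicative ℤ))) = 0) ∧
      ∀ (ψ : AddChar ((vRat 2).adicCompletion ℚ) Circle), Continuous ψ → (∃ y, ψ y ≠ 1) →
        conductorExp ψ (Valued.v : Valuation ((vRat 2).adicCompletion ℚ) (WithZero (Multiplicative ℤ))) = 0 →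
        ∀ (w' : HeightOneSpectrum (𝓞 K)) [w'.asIdeal.LiesOver v.asIdeal],
          v.asIdeal.ramificationIdx' w'.asIdeal = 1 ∧
          conductorExp (recordChar K (vRat 2) v w' ψ)
            (Valued.v : Valuation (w'.adicCompletion K) (WithZero (Multiplicative ℤ))) = 0 ∧
          (∀ x : w'.adicCompletion K,
            (∀ y : w'.adicCompletion K, Valued.v y ≤ 1 → recordChar K (vRat 2) v w' ψ (x * y) = 1) ↔ Valued.v x ≤ 1) ∧
          (∀ [StarRing (w'.adicCompletion K)],
            (∀ z : w'.adicCompletion K, IsLocalization.IsInteger (w'.adicCompletionIntegers K) z →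
              IsLocalization.IsInteger (w'.adicCompletionIntegers K) (star z)) →
            ∀ x : Fin 3 → w'.adicCompletion K,
              (∀ y ∈ stdLattice (w'.adicCompletionIntegers K),
                recordChar K (vRat 2) v w' ψ
                  (sesqForm (((algebraMap (𝓞 K) K).mapMatrix (Matrix.diagonal ![1, 1, -1])).map (algebraMap K (w'.adicCompletion K))) x y) = 1) ↔
                x ∈ stdLattice (w'.adicCompletionIntegers K)) ∧
          (letI := swapStarRing (w'.adicCompletion K)
            ∀ x : Fin 3 → w'.adicCompletion K × w'.adicCompletion K,
              (∀ y : Fin 3 → w'.adicCompletion K × w'.adicCompletion K,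
                (∀ i, Valued.v (y i).1 ≤ 1 ∧ Valued.v (y i).2 ≤ 1) →
                recordChar K (vRat 2) v w' ψ
                    (sesqForm (pairMatrix (((algebraMap (𝓞 K) K).mapMatrix (Matrix.diagonal ![1, 1, -1])).map (algebraMap K (w'.adicCompletion K)))
                      (((algebraMap (𝓞 K) K).mapMatrix (Matrix.diagonal ![1, 1, -1])).map (algebraMap K (w'.adicCompletion K)))ᵀ) x y).1 *
                  recordChar K (vRat 2) v w' ψ
                    (sesqForm (pairMatrix (((algebraMap (𝓞 K) K).mapMatrix (Matrix.diagonal ![1, 1, -1])).map (algebraMap K (w'.adicCompletion K)))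
                      (((algebraMap (𝓞 K) K).mapMatrix (Matrix.diagonal ![1, 1, -1])).map (algebraMap K (w'.adicCompletion K)))ᵀ) x y).2 = 1) ↔
                ∀ i, Valued.v (x i).1 ≤ 1 ∧ Valued.v (x i).2 ≤ 1)) ∧
      (∃ (θ : maximalRealSubfield K) (y : K) (hθ : algebraMap (maximalRealSubfield K) K θ = y ^ 2)
        (hy : complexConj K y ≠ y) (r : ℕ) (l : Fin r → 𝓞 K)
        (_hl : Submodule.span (𝓞 (maximalRealSubfield K)) (Set.range l) = ⊤),
        letI := tensorStarRing K v
        letI := starRingOfQuadratic (finrank_eq_two K v w hθ hy (not_isSquare_of_staysPrime K v w hθ hy hmap))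
          (localConj v w hθ.symm (span_pair_eq_top K hy) (not_isSquare_of_staysPrime K v w hθ hy hmap) (complexConj K))
          (localConj_ne_one v w hθ.symm (span_pair_eq_top K hy) (not_isSquare_of_staysPrime K v w hθ hy hmap)
            (complexConj K) (complexConj_apply_eq_neg K hθ hy))
        haveI := isDiscreteValuationRing_integralClosure_adicCompletion v w
        haveI := finite_residueField_integralClosure_adicCompletion v w
        haveI : IsFractionRing (integralClosure (v.adicCompletionIntegers (maximalRealSubfield K)) (w.adicCompletion K))
          (w.adicCompletion K) :=
          integralClosure.isFractionRing_of_finite_extension (v.adicCompletion (maximalRealSubfield K))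
            (w.adicCompletion K)
        ∃ (u₀ : (v.adicCompletionIntegers (maximalRealSubfield K))ˣ)
          (Φ : ↥(formUnitaryGroup (J3 (algebraMap (v.adicCompletionIntegers (maximalRealSubfield K))
            (w.adicCompletion K) (u₀ : v.adicCompletionIntegers (maximalRealSubfield K))))) ≃*
            ↥(formUnitaryGroup (tensorGram K v (gramToy K))))
          (ϖ' : integralClosure (v.adicCompletionIntegers (maximalRealSubfield K)) (w.adicCompletion K))
          (hϖ' : Irreducible ϖ')
          (hs' : star (algebraMap (integralClosure (v.adicCompletionIntegers (maximalRealSubfield K))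
            (w.adicCompletion K)) (w.adicCompletion K) ϖ') =
              algebraMap (integralClosure (v.adicCompletionIntegers (maximalRealSubfield K)) (w.adicCompletion K))
                (w.adicCompletion K) ϖ'),
          (∀ g, g ∈ hyperspecialSubgroup
              (integralClosure (v.adicCompletionIntegers (maximalRealSubfield K)) (w.adicCompletion K))
              (J3 (algebraMap (v.adicCompletionIntegers (maximalRealSubfield K)) (w.adicCompletion K)
                (u₀ : v.adicCompletionIntegers (maximalRealSubfield K)))) ↔ Φ g ∈ recordHyperspecial K v l (gramToy K)) ∧
          ∀ {V : Type uV} [AddCommGroup V] [Module k V]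
            (ρ : Representation k (↥(formUnitaryGroup (tensorGram K v (gramToy K)))) V) [ρ.IsIrreducible],
            KFinite ρ (recordHyperspecial K v l (gramToy K)) →
            ∀ [FiniteDimensional k (invariants ρ (recordHyperspecial K v l (gramToy K)))],
            invariants ρ (recordHyperspecial K v l (gramToy K)) ≠ ⊥ →
            ∃ α : k, α ≠ 0 ∧ Nonempty (ρ.Equiv (comp Φ.symm
              (inertSphericalQuot
                (hstar_of_star_eq (localConj v w hθ.symm (span_pair_eq_top K hy)
                  (not_isSquare_of_staysPrime K v w hθ hy hmap) (complexConj K))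
                  (fun x => by rw [star_p8_eq_star K v w hθ hy (not_isSquare_of_staysPrime K v w hθ hy hmap)]; rfl))
                (algebraMap (v.adicCompletionIntegers (maximalRealSubfield K)) (w.adicCompletion K)
                  (u₀ : v.adicCompletionIntegers (maximalRealSubfield K)))
                (star_algebraMap_of_star_eq (localConj v w hθ.symm (span_pair_eq_top K hy)
                  (not_isSquare_of_staysPrime K v w hθ hy hmap) (complexConj K))
                  (fun x => by rw [star_p8_eq_star K v w hθ hy (not_isSquare_of_staysPrime K v w hθ hy hmap)]; rfl)
                  (u₀ : v.adicCompletionIntegers (maximalRealSubfield K)))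
                (algebraMap_unit_ne_zero (F := v.adicCompletion (maximalRealSubfield K)) u₀)
                (isInteger_algebraMap (u₀ : v.adicCompletionIntegers (maximalRealSubfield K)))
                (isInteger_algebraMap_unit_inv u₀) hϖ' hs' k (α * ((Ideal.absNorm v.asIdeal : k) ^ 2)⁻¹))))) :=
  haveI := numberField_nine K
  haveI := isCMField_nine K
  (exists_map_eq_two K P v).1.elim fun w hmap =>
    ⟨w, hmap, @joint_outside_discriminant_of_staysPrime K _ (numberField_nine K) (isCMField_nine K) (vRat 2) v
      (liesOver_vRat_of_mem 2 v (natCast_mem_of_liesOver_of_liesOver K 2 P v))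
      (discr_nine_notMem K 2 (by norm_num) v (natCast_mem_of_liesOver_of_liesOver K 2 P v)) w
      (liesOver_of_map_eq K v w hmap) hmap k _ _ _⟩

/-- **JOINT CONSISTENCY ON `ℚ(ζ₉)` AT EVERY PLACE ABOVE `17`** (`17 ≡ −1 (mod 9)`: `f(v/17) = 1`, `N(v) = 17` — a
DEGREE-ONE inert place, the record's `exists_map_eq_seventeen`): the place `w` with `v 𝓞_K = w` is supplied. -/
theorem joint_nine_seventeen (P : Ideal (𝓞 K)) [P.IsPrime] [P.LiesOver (Ideal.span {(17 : ℤ)})]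
    (v : HeightOneSpectrum (𝓞 (maximalRealSubfield K))) [P.LiesOver v.asIdeal] :
    haveI : Fact (Nat.Prime 17) := ⟨by norm_num⟩
    haveI := numberField_nine K
    haveI := isCMField_nine K
    letI : v.asIdeal.LiesOver (vRat 17).asIdeal := liesOver_vRat_of_mem 17 v (natCast_mem_of_liesOver_of_liesOver K 17 P v)
    ∃ (w : HeightOneSpectrum (𝓞 K))
      (hmap : Ideal.map (algebraMap (𝓞 (maximalRealSubfield K)) (𝓞 K)) v.asIdeal = w.asIdeal),
      letI := liesOver_of_map_eq K v w hmap
      ((∃ ψ : AddChar ((vRat 17).adicCompletion ℚ) Circle, Continuous ψ ∧ (∃ y, ψ y ≠ 1) ∧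
        conductorExp ψ (Valued.v : Valuation ((vRat 17).adicCompletion ℚ) (WithZero (Multiplicative ℤ))) = 0 ∧
        conductorExp (ψ.compAddMonoidHom
          (Algebra.trace ((vRat 17).adicCompletion ℚ) (v.adicCompletion (maximalRealSubfield K))).toAddMonoidHom)
          (Valued.v : Valuation (v.adicCompletion (maximalRealSubfield K)) (WithZero (Multiplicative ℤ))) = 0) ∧
      ∀ (ψ : AddChar ((vRat 17).adicCompletion ℚ) Circle), Continuous ψ → (∃ y, ψ y ≠ 1) →
        conductorExp ψ (Valued.v : Valuation ((vRat 17).adicCompletion ℚ) (WithZero (Multiplicative ℤ))) = 0 →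
        ∀ (w' : HeightOneSpectrum (𝓞 K)) [w'.asIdeal.LiesOver v.asIdeal],
          v.asIdeal.ramificationIdx' w'.asIdeal = 1 ∧
          conductorExp (recordChar K (vRat 17) v w' ψ)
            (Valued.v : Valuation (w'.adicCompletion K) (WithZero (Multiplicative ℤ))) = 0 ∧
          (∀ x : w'.adicCompletion K,
            (∀ y : w'.adicCompletion K, Valued.v y ≤ 1 → recordChar K (vRat 17) v w' ψ (x * y) = 1) ↔ Valued.v x ≤ 1) ∧
          (∀ [StarRing (w'.adicCompletion K)],
            (∀ z : w'.adicCompletion K, IsLocalization.IsInteger (w'.adicCompletionIntegers K) z →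
              IsLocalization.IsInteger (w'.adicCompletionIntegers K) (star z)) →
            ∀ x : Fin 3 → w'.adicCompletion K,
              (∀ y ∈ stdLattice (w'.adicCompletionIntegers K),
                recordChar K (vRat 17) v w' ψ
                  (sesqForm (((algebraMap (𝓞 K) K).mapMatrix (Matrix.diagonal ![1, 1, -1])).map (algebraMap K (w'.adicCompletion K))) x y) = 1) ↔
                x ∈ stdLattice (w'.adicCompletionIntegers K)) ∧
          (letI := swapStarRing (w'.adicCompletion K)
            ∀ x : Fin 3 → w'.adicCompletion K × w'.adicCompletion K,
              (∀ y : Fin 3 → w'.adicCompletion K × w'.adicCompletion K,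
                (∀ i, Valued.v (y i).1 ≤ 1 ∧ Valued.v (y i).2 ≤ 1) →
                recordChar K (vRat 17) v w' ψ
                    (sesqForm (pairMatrix (((algebraMap (𝓞 K) K).mapMatrix (Matrix.diagonal ![1, 1, -1])).map (algebraMap K (w'.adicCompletion K)))
                      (((algebraMap (𝓞 K) K).mapMatrix (Matrix.diagonal ![1, 1, -1])).map (algebraMap K (w'.adicCompletion K)))ᵀ) x y).1 *
                  recordChar K (vRat 17) v w' ψ
                    (sesqForm (pairMatrix (((algebraMap (𝓞 K) K).mapMatrix (Matrix.diagonal ![1, 1, -1])).map (algebraMap K (w'.adicCompletion K)))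
                      (((algebraMap (𝓞 K) K).mapMatrix (Matrix.diagonal ![1, 1, -1])).map (algebraMap K (w'.adicCompletion K)))ᵀ) x y).2 = 1) ↔
                ∀ i, Valued.v (x i).1 ≤ 1 ∧ Valued.v (x i).2 ≤ 1)) ∧
      (∃ (θ : maximalRealSubfield K) (y : K) (hθ : algebraMap (maximalRealSubfield K) K θ = y ^ 2)
        (hy : complexConj K y ≠ y) (r : ℕ) (l : Fin r → 𝓞 K)
        (_hl : Submodule.span (𝓞 (maximalRealSubfield K)) (Set.range l) = ⊤),
        letI := tensorStarRing K v
        letI := starRingOfQuadratic (finrank_eq_two K v w hθ hy (not_isSquare_of_staysPrime K v w hθ hy hmap))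
          (localConj v w hθ.symm (span_pair_eq_top K hy) (not_isSquare_of_staysPrime K v w hθ hy hmap) (complexConj K))
          (localConj_ne_one v w hθ.symm (span_pair_eq_top K hy) (not_isSquare_of_staysPrime K v w hθ hy hmap)
            (complexConj K) (complexConj_apply_eq_neg K hθ hy))
        haveI := isDiscreteValuationRing_integralClosure_adicCompletion v w
        haveI := finite_residueField_integralClosure_adicCompletion v w
        haveI : IsFractionRing (integralClosure (v.adicCompletionIntegers (maximalRealSubfield K)) (w.adicCompletion K))
          (w.adicCompletion K) :=
          integralClosure.isFractionRing_of_finite_extension (v.adicCompletion (maximalRealSubfield K))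
            (w.adicCompletion K)
        ∃ (u₀ : (v.adicCompletionIntegers (maximalRealSubfield K))ˣ)
          (Φ : ↥(formUnitaryGroup (J3 (algebraMap (v.adicCompletionIntegers (maximalRealSubfield K))
            (w.adicCompletion K) (u₀ : v.adicCompletionIntegers (maximalRealSubfield K))))) ≃*
            ↥(formUnitaryGroup (tensorGram K v (gramToy K))))
          (ϖ' : integralClosure (v.adicCompletionIntegers (maximalRealSubfield K)) (w.adicCompletion K))
          (hϖ' : Irreducible ϖ')
          (hs' : star (algebraMap (integralClosure (v.adicCompletionIntegers (maximalRealSubfield K))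
            (w.adicCompletion K)) (w.adicCompletion K) ϖ') =
              algebraMap (integralClosure (v.adicCompletionIntegers (maximalRealSubfield K)) (w.adicCompletion K))
                (w.adicCompletion K) ϖ'),
          (∀ g, g ∈ hyperspecialSubgroup
              (integralClosure (v.adicCompletionIntegers (maximalRealSubfield K)) (w.adicCompletion K))
              (J3 (algebraMap (v.adicCompletionIntegers (maximalRealSubfield K)) (w.adicCompletion K)
                (u₀ : v.adicCompletionIntegers (maximalRealSubfield K)))) ↔ Φ g ∈ recordHyperspecial K v l (gramToy K)) ∧
          ∀ {V : Type uV} [AddCommGroup V] [Module k V]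
            (ρ : Representation k (↥(formUnitaryGroup (tensorGram K v (gramToy K)))) V) [ρ.IsIrreducible],
            KFinite ρ (recordHyperspecial K v l (gramToy K)) →
            ∀ [FiniteDimensional k (invariants ρ (recordHyperspecial K v l (gramToy K)))],
            invariants ρ (recordHyperspecial K v l (gramToy K)) ≠ ⊥ →
            ∃ α : k, α ≠ 0 ∧ Nonempty (ρ.Equiv (comp Φ.symm
              (inertSphericalQuot
                (hstar_of_star_eq (localConj v w hθ.symm (span_pair_eq_top K hy)
                  (not_isSquare_of_staysPrime K v w hθ hy hmap) (complexConj K))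
                  (fun x => by rw [star_p8_eq_star K v w hθ hy (not_isSquare_of_staysPrime K v w hθ hy hmap)]; rfl))
                (algebraMap (v.adicCompletionIntegers (maximalRealSubfield K)) (w.adicCompletion K)
                  (u₀ : v.adicCompletionIntegers (maximalRealSubfield K)))
                (star_algebraMap_of_star_eq (localConj v w hθ.symm (span_pair_eq_top K hy)
                  (not_isSquare_of_staysPrime K v w hθ hy hmap) (complexConj K))
                  (fun x => by rw [star_p8_eq_star K v w hθ hy (not_isSquare_of_staysPrime K v w hθ hy hmap)]; rfl)
                  (u₀ : v.adicCompletionIntegers (maximalRealSubfield K)))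
                (algebraMap_unit_ne_zero (F := v.adicCompletion (maximalRealSubfield K)) u₀)
                (isInteger_algebraMap (u₀ : v.adicCompletionIntegers (maximalRealSubfield K)))
                (isInteger_algebraMap_unit_inv u₀) hϖ' hs' k (α * ((Ideal.absNorm v.asIdeal : k) ^ 2)⁻¹))))) :=
  haveI : Fact (Nat.Prime 17) := ⟨by norm_num⟩
  haveI := numberField_nine K
  haveI := isCMField_nine K
  (exists_map_eq_seventeen K P v).1.elim fun w hmap =>
    ⟨w, hmap, @joint_outside_discriminant_of_staysPrime K _ (numberField_nine K) (isCMField_nine K) (vRat 17) v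
      (liesOver_vRat_of_mem 17 v (natCast_mem_of_liesOver_of_liesOver K 17 P v))
      (discr_nine_notMem K 17 (by norm_num) v (natCast_mem_of_liesOver_of_liesOver K 17 P v)) w
      (liesOver_of_map_eq K v w hmap) hmap k _ _ _⟩

end Summit.Ventures.HodgeRepro2.T5RecordJointNineNumerals
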